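import Mathlib.RepresentationTheory.Invariants
import Mathlib.LinearAlgebra.FiniteDimensional.Basic
import Mathlib.LinearAlgebra.Dual.Lemmas
import Mathlib.Algebra.Module.Projective
import Mathlib.Topology.Algebra.Ring.Basic
import Mathlib.Topology.Algebra.Group.Basic
import HarnessLib

/-!
# Non-principal continuous crossed homomorphisms from invariant vectors (`H¹ ≠ 0` from `H⁰ ≠ 0`)

Topic `NumberTheory/GaloisRepresentations` (continuous group cohomology in degree one, element
level).  Theorems only (no definition, no named fact).

Let `Q` be a topological group and `𝕜` a topological field such that
* every continuous `𝕜`-valued `2`-cocycle of `Q` (trivial action) is the coboundary of a continuous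
  `1`-cochain ("`H²_cont(Q, 𝕜) = 0`", e.g. `Q` an open subgroup of the absolute Galois group of a
  `p`-adic field and `𝕜 = ℚ_l`, [NSW] (7.3.10) / the tree's
  `deltaInv_two_eq_zero_of_isOpen_absoluteGaloisGroup`), and
* `Q` admits a non-zero continuous additive character `φ : Q → 𝕜` ("`δ¹_l(Q) ≥ 1`").
Then for every finite-dimensional `𝕜`-linear representation `ρ` of `Q` with continuous matrix
coefficients and a NON-ZERO INVARIANT VECTOR there is a continuous crossed homomorphism
`ξ : Q → V` (`ξ(gh) = ξ(g) + g ξ(h)`) which is NOT principal (`ξ ≠ (g ↦ g v - v)`), i.e.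
`H¹_cont(Q, V) ≠ 0` (`exists_crossedHom_not_principal_of_invariants_ne_bot`).  Proof by induction on
`dim V` along `W := V^Q`: if `(V/W)^Q = 0` the crossed homomorphism `g ↦ φ(g) w₀` (`w₀ ∈ W ∖ 0`) is
not principal; otherwise a non-principal crossed homomorphism of `V/W` lifts to `V`, the obstruction
being a continuous `2`-cocycle with values in the trivial module `W ≅ 𝕜^m`.

This is the element-level form of "`H¹(G, Hom(R_{l′}, ℚ_{l′})) = H¹(G, ℚ_{l′}) ⊗ Hom(R_{l′}, ℚ_{l′}) ≠ 0`"
in the proof of [AbsTopI] Thm 2.6 (iii) (S. Mochizuki, *Topics in Absolute Anabelian Geometry I*,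
p. 23), for an ARBITRARY finite-dimensional `V` with `V^G ≠ 0` in place of the trivial-action
quotient `Hom(R, ℚ_l)` of Lemma 2.7 (ii)/(iii) — which is what lets the abc-iut cell derive the
Lemma 2.7 (iii) step from condition (∗)_Σ alone (row «HOOK-FROM-SIGMA-STAR»).  Continuity is carried
in the weak form "`q ↦ f(ρ(q) v)` continuous for every linear functional `f`", which for
finite-dimensional `V` is all that is ever used.  Classical; nothing here bears on [IUTchIII] Cor. 3.12.

## References
* J. Neukirch, A. Schmidt, K. Wingberg, *Cohomology of Number Fields*, 2nd ed. (2008), I §2–3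
  (inhomogeneous continuous cochains, the long exact sequence in low degrees). [NeukirchSchmidtWingberg2008]
* S. Mochizuki, *Topics in Absolute Anabelian Geometry I: Generalities*, J. Math. Sci. Univ. Tokyo 19
  (2012), proof of Thm 2.6 (iii) p. 23. [MochizukiAbsTopI2012]
-/

namespace Literature.NumberTheory.GaloisRepresentations

universe uQ uk uV

variable {Q : Type uQ} [Group Q] [TopologicalSpace Q] [IsTopologicalGroup Q]
variable {𝕜 : Type uk} [Field 𝕜] [TopologicalSpace 𝕜] [IsTopologicalRing 𝕜]

omit [IsTopologicalGroup Q] in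
/-- **Joint continuity of matrix coefficients against a weakly continuous map.**  If every matrix
coefficient `q ↦ f(ρ(q) v)` of a representation on a finite-dimensional space is continuous and
`Φ : X → V` is weakly continuous (`x ↦ f(Φ x)` continuous for every functional `f`), then
`(q, x) ↦ f(ρ(q) Φ(x))` is jointly continuous (expand `Φ(x)` in a basis; the joint-continuity
bookkeeping of continuous cochains with values in a finite-dimensional module).
[cite: NeukirchSchmidtWingberg2008, I §2] -/
theorem continuous_dual_rep_apply_of_weakly_continuous {V : Type uV} [AddCommGroup V] [Module 𝕜 V]
    [FiniteDimensional 𝕜 V] (ρ : Representation 𝕜 Q V)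
    (hρ : ∀ (v : V) (f : Module.Dual 𝕜 V), Continuous fun q => f (ρ q v))
    {X : Type*} [TopologicalSpace X] (Φ : X → V)
    (hΦ : ∀ f : Module.Dual 𝕜 V, Continuous fun x => f (Φ x)) (f : Module.Dual 𝕜 V) :
    Continuous fun p : Q × X => f (ρ p.1 (Φ p.2)) := by
  let e := Module.finBasis 𝕜 V
  have hexp : ∀ p : Q × X,
      f (ρ p.1 (Φ p.2)) = ∑ j, e.coord j (Φ p.2) * f (ρ p.1 (e j)) := by
    intro p
    conv_lhs => rw [← e.sum_repr (Φ p.2)]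
    simp only [map_sum, map_smul, smul_eq_mul, Module.Basis.coord_apply]
  simp_rw [hexp]
  refine continuous_finsetSum _ fun j _ => ?_
  exact ((hΦ (e.coord j)).comp continuous_snd).mul ((hρ (e j) f).comp continuous_fst)

/-- **`H¹_cont(Q, V) ≠ 0` from `V^Q ≠ 0`** (element level).  Let `Q` be a topological group all of
whose continuous `𝕜`-valued `2`-cocycles (trivial action) are coboundaries of continuous cochains
(`hH2`) and which carries a non-zero continuous additive character `φ` (`hφ0`).  Then every
finite-dimensional representation `ρ` of `Q` with continuous matrix coefficients and `ρ.invariants ≠ ⊥`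
admits a weakly continuous crossed homomorphism `ξ : Q → V`, `ξ(gh) = ξ(g) + ρ(g) ξ(h)`, which is
not of the form `g ↦ ρ(g) v - v`.  (Induction on `dim V` along the invariants `W`: either
`(V/W)^Q = 0` and `g ↦ φ(g) • w₀` works, or a non-principal crossed homomorphism of `V/W` lifts, the
obstruction being a `W`-valued continuous `2`-cocycle, killed coordinatewise by `hH2`.)
[cite: NeukirchSchmidtWingberg2008, I §3] -/
theorem exists_crossedHom_not_principal_of_invariants_ne_bot
    (hH2 : ∀ c : Q × Q → 𝕜, Continuous c →
      (∀ g h k : Q, c (h, k) + c (g, h * k) = c (g * h, k) + c (g, h)) →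
      ∃ b : Q → 𝕜, Continuous b ∧ ∀ g h : Q, c (g, h) = b h - b (g * h) + b g)
    (φ : Q → 𝕜) (hφc : Continuous φ) (hφ : ∀ g h : Q, φ (g * h) = φ g + φ h)
    (hφ0 : ∃ g : Q, φ g ≠ 0)
    {V : Type uV} [AddCommGroup V] [Module 𝕜 V] [FiniteDimensional 𝕜 V]
    (ρ : Representation 𝕜 Q V)
    (hρ : ∀ (v : V) (f : Module.Dual 𝕜 V), Continuous fun q => f (ρ q v))
    (hinv : ρ.invariants ≠ ⊥) :
    ∃ ξ : Q → V, (∀ g h : Q, ξ (g * h) = ξ g + ρ g (ξ h)) ∧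
      (∀ f : Module.Dual 𝕜 V, Continuous fun q => f (ξ q)) ∧
      ∀ v : V, ξ ≠ fun g => ρ g v - v := by
  -- induction on the dimension, the space varying
  suffices key : ∀ (n : ℕ) {V : Type uV} [AddCommGroup V] [Module 𝕜 V] [FiniteDimensional 𝕜 V]
      (ρ : Representation 𝕜 Q V),
      (∀ (v : V) (f : Module.Dual 𝕜 V), Continuous fun q => f (ρ q v)) →
      ρ.invariants ≠ ⊥ → Module.finrank 𝕜 V = n →
      ∃ ξ : Q → V, (∀ g h : Q, ξ (g * h) = ξ g + ρ g (ξ h)) ∧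
        (∀ f : Module.Dual 𝕜 V, Continuous fun q => f (ξ q)) ∧
        ∀ v : V, ξ ≠ fun g => ρ g v - v from
    key _ ρ hρ hinv rfl
  intro n
  induction n using Nat.strong_induction_on with
  | _ n ih =>
  intro V _ _ _ ρ hρ hinv hn
  -- the invariants `W` and the quotient representation `ρ'` on `V ⧸ W`
  set W : Submodule 𝕜 V := ρ.invariants with hWdef
  have hWinv : ∀ (g : Q) (w : V), w ∈ W → ρ g w = w := fun g w hw =>
    (ρ.mem_invariants w).1 hw g
  have hWle : ∀ g : Q, W ≤ W.comap (ρ g) := by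
    intro g w hw
    rw [Submodule.mem_comap, hWinv g w hw]
    exact hw
  let ρ' : Representation 𝕜 Q (V ⧸ W) := ρ.quotient W hWle
  have hρ'mk : ∀ (g : Q) (v : V), ρ' g (Submodule.Quotient.mk v) = Submodule.Quotient.mk (ρ g v) :=
    fun g v => rfl
  have hρ' : ∀ (v' : V ⧸ W) (f' : Module.Dual 𝕜 (V ⧸ W)), Continuous fun q => f' (ρ' q v') := by
    intro v' f'
    obtain ⟨v, rfl⟩ := W.mkQ_surjective v'
    have : (fun q => f' (ρ' q (W.mkQ v))) = fun q => (f'.comp W.mkQ) (ρ q v) := by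
      funext q
      rw [Submodule.mkQ_apply, hρ'mk, LinearMap.comp_apply, Submodule.mkQ_apply]
    rw [this]
    exact hρ v _
  by_cases hbot : ρ'.invariants = ⊥
  · /- Case A: `(V/W)^Q = 0`.  Take `ξ g := φ g • w₀` with `0 ≠ w₀ ∈ W`. -/
    obtain ⟨w₀, hw₀W, hw₀⟩ := Submodule.exists_mem_ne_zero_of_ne_bot hinv
    refine ⟨fun g => φ g • w₀, fun g h => ?_, fun f => ?_, fun v hv => ?_⟩
    · dsimp only
      rw [hφ, add_smul, map_smul, hWinv g w₀ hw₀W]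
    · simp_rw [map_smul, smul_eq_mul]
      exact hφc.mul continuous_const
    · -- `ρ g v - v = φ g • w₀ ∈ W` for all `g`, so `[v]` is invariant in `V/W`, so `v ∈ W`, so `φ = 0`
      have hgv : ∀ g : Q, ρ g v - v = φ g • w₀ := fun g => (congrFun hv g).symm
      have hmem : Submodule.Quotient.mk (p := W) v ∈ ρ'.invariants := by
        rw [Representation.mem_invariants]
        intro g
        rw [hρ'mk, ← sub_eq_zero, ← Submodule.Quotient.mk_sub, Submodule.Quotient.mk_eq_zero, hgv g]
        exact W.smul_mem _ hw₀W
      rw [hbot, Submodule.mem_bot, Submodule.Quotient.mk_eq_zero] at hmem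
      obtain ⟨g, hg⟩ := hφ0
      have h0 : φ g • w₀ = 0 := by rw [← hgv g, hWinv g v hmem, sub_self]
      rcases smul_eq_zero.1 h0 with h | h
      · exact hg h
      · exact hw₀ h
  · /- Case B: `(V/W)^Q ≠ 0`.  Lift a non-principal crossed homomorphism of `V ⧸ W`. -/
    have hWpos : 0 < Module.finrank 𝕜 W := by
      rw [pos_iff_ne_zero, Ne, Submodule.finrank_eq_zero]
      exact hinv
    have hlt : Module.finrank 𝕜 (V ⧸ W) < n := by
      have := W.finrank_quotient_add_finrank
      omega
    obtain ⟨ζ, hζ1, hζ2, hζ3⟩ := ih _ hlt ρ' hρ' hbot rfl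
    -- a linear section of `V ↠ V/W` and a linear retraction of `W ↪ V`
    obtain ⟨s, hs⟩ := W.mkQ.exists_rightInverse_of_surjective W.range_mkQ
    have hs' : ∀ x : V ⧸ W, Submodule.Quotient.mk (s x) = x := fun x => by
      rw [← Submodule.mkQ_apply, ← LinearMap.comp_apply, hs, LinearMap.id_apply]
    obtain ⟨r, hr⟩ := W.subtype.exists_leftInverse_of_injective W.ker_subtype
    have hr' : ∀ w : W, r (w : V) = w := fun w => by
      rw [← Submodule.subtype_apply, ← LinearMap.comp_apply, hr, LinearMap.id_apply]
    let b := Module.finBasis 𝕜 W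
    -- the lifted cochain and its defect
    let d : Q → Q → V := fun g h => s (ζ g) + ρ g (s (ζ h)) - s (ζ (g * h))
    have hdW : ∀ g h : Q, d g h ∈ W := by
      intro g h
      rw [← Submodule.Quotient.mk_eq_zero, Submodule.Quotient.mk_sub, Submodule.Quotient.mk_add,
        ← hρ'mk, hs', hs', hs', hζ1 g h, sub_self]
    -- coordinates of the defect along the basis `b` of `W`: the functionals `F i`
    let F : Fin (Module.finrank 𝕜 W) → Module.Dual 𝕜 V := fun i => (b.coord i).comp r
    have hdexp : ∀ g h : Q, d g h = ∑ i, F i (d g h) • (b i : V) := by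
      intro g h
      have hrep := b.sum_repr (⟨d g h, hdW g h⟩ : W)
      have hcoe := congrArg (fun w : W => (w : V)) hrep
      simp only [Submodule.coe_sum, Submodule.coe_smul] at hcoe
      conv_lhs => rw [← hcoe]
      refine Finset.sum_congr rfl fun i _ => ?_
      congr 1
      change b.repr ⟨d g h, hdW g h⟩ i = b.coord i (r (d g h))
      rw [Module.Basis.coord_apply, hr' ⟨d g h, hdW g h⟩]
    -- the defect is a `2`-cocycle (with values in the trivial module `W`)
    have hdcoc : ∀ g h k : Q, d h k + d g (h * k) = d (g * h) k + d g h := by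
      intro g h k
      have hfix : ρ g (d h k) = d h k := hWinv g _ (hdW h k)
      have hkey : d h k + d g (h * k) - (d (g * h) k + d g h) = d h k - ρ g (d h k) := by
        simp only [d, map_add, map_sub, map_mul, Module.End.mul_apply, mul_assoc]
        abel
      rw [hfix, sub_self] at hkey
      exact sub_eq_zero.1 hkey
    -- each coordinate is a continuous scalar `2`-cocycle, hence a continuous coboundary
    have hFcont : ∀ i, Continuous fun p : Q × Q => F i (d p.1 p.2) := by
      intro i
      have h1 : Continuous fun p : Q × Q => F i (s (ζ p.1)) :=
        (hζ2 ((F i).comp s)).comp continuous_fst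
      have h2 : Continuous fun p : Q × Q => F i (ρ p.1 (s (ζ p.2))) :=
        continuous_dual_rep_apply_of_weakly_continuous ρ hρ (fun h => s (ζ h))
          (fun f => hζ2 (f.comp s)) (F i)
      have h3 : Continuous fun p : Q × Q => F i (s (ζ (p.1 * p.2))) :=
        (hζ2 ((F i).comp s)).comp (continuous_fst.mul continuous_snd)
      refine ((h1.add h2).sub h3).congr fun p => ?_
      simp only [d, map_add, map_sub, Pi.add_apply, Pi.sub_apply]
    have hβ : ∀ i, ∃ β : Q → 𝕜, Continuous β ∧
        ∀ g h : Q, F i (d g h) = β h - β (g * h) + β g := by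
      intro i
      refine hH2 (fun p => F i (d p.1 p.2)) (hFcont i) fun g h k => ?_
      change F i (d h k) + F i (d g (h * k)) = F i (d (g * h) k) + F i (d g h)
      rw [← map_add, ← map_add, hdcoc]
    choose β hβc hβ using hβ
    -- the corrected lift
    let B : Q → V := fun g => ∑ i, β i g • (b i : V)
    have hBW : ∀ g : Q, B g ∈ W := fun g =>
      W.sum_mem fun i _ => W.smul_mem _ (b i).2
    refine ⟨fun g => s (ζ g) - B g, fun g h => ?_, fun f => ?_, fun v hv => ?_⟩
    · -- crossed homomorphism: the defect equals the coboundary of `B`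
      dsimp only
      have hBfix : ρ g (B h) = B h := hWinv g _ (hBW h)
      have hdB : d g h = B g + B h - B (g * h) := by
        rw [hdexp g h]
        simp only [B, ← Finset.sum_add_distrib, ← Finset.sum_sub_distrib, ← add_smul, ← sub_smul]
        refine Finset.sum_congr rfl fun i _ => ?_
        rw [hβ i g h]
        congr 1
        ring
      have : s (ζ (g * h)) = s (ζ g) + ρ g (s (ζ h)) - d g h := by
        simp only [d]; abel
      rw [this, hdB, map_sub, hBfix]
      abel
    · -- weak continuity
      have h1 : Continuous fun q => f (s (ζ q)) := hζ2 (f.comp s)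
      have h2 : Continuous fun q => f (B q) := by
        simp only [B, map_sum, map_smul, smul_eq_mul]
        exact continuous_finsetSum _ fun i _ => (hβc i).mul continuous_const
      refine (h1.sub h2).congr fun q => ?_
      simp only [map_sub, Pi.sub_apply]
    · -- not principal: its image in `V ⧸ W` is `ζ`, which is not principal
      refine hζ3 (Submodule.Quotient.mk v) (funext fun g => ?_)
      have hg := congrArg (Submodule.Quotient.mk (p := W)) (congrFun hv g)
      rw [Submodule.Quotient.mk_sub, hs', (Submodule.Quotient.mk_eq_zero W).2 (hBW g), sub_zero,
        Submodule.Quotient.mk_sub, ← hρ'mk] at hg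
      exact hg

end Literature.NumberTheory.GaloisRepresentations
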